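import Literature.MathematicalPhysics.QuantumFieldTheory.Balaban1983to89.B8Prop5NestedServerPerBody

/-!
# [B8] Proposition 5, EXISTENCE (1.107)–(1.108): pub-ymgap T5's guarded sockets `SP5base` ∕ `SP5` at NESTED `P`-PERIODIC MEMBERS — THE BINDER TEXTS
VERBATIM at instance (i) `LanF := IsLandau138W`, from FILE 1's one-member bodies (B8-P5-NESTED-SERVER, existence half, FILE 2)

Bałaban, *Comm. Math. Phys.* **99** (1985) 75–102 ([B8]; PDF page = printed page − 74), Prop. 5 p. 94, Thm 4 p. 88, pp. 88–89 + 94–95, (1.29) p. 81,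
(1.33)–(1.38) p. 82, (1.66) p. 88, (1.68)–(1.69) p. 88, p. 77 («Ω_j ⊂ T_η»); [4] = Bałaban, *Comm. Math. Phys.* **99** (1985) 389–434, Thm 3.1 p. 397,
Thm 3.3 p. 399, (3.19) p. 393.

WHAT THIS FILE SERVES (lead g33's WAKE-B8P5NestedServerExist for pub-ymgap dag-n05-c's T5
`B8Thm4CoreZdGF3HP2PerLanEGamma.thm4Core_zdGF3HP₂Per_map_lanE_γ'` p653438).  T5 demands, over an index map `ι : J → ZdIdx d L` and a period map
`p : J → ℕ`, two Prop-5 EXISTENCE sockets AT `(p a)`-PERIODIC ARGUMENTS: `SP5base` (:117–:130; level `1` from the datum `u₁ = 1`, `U₁ = U′`, p. 89) and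
`SP5` (:131–:149; level `m + 1` from a periodic level-`m` datum `(u₁, U₁ = e^{iηA}, A)` with (1.29)_m, `LanF a U₀ φ m U₁`, (1.69)).  Here both binder texts are
CONCLUDED TOKEN FOR TOKEN at the zero-source instance (i) `LanF a U₀ φ m W := IsLandau138W L m (ι a).η ((ι a).Ω 0) ((ι a).Λs m) U₀ W` (T6a ∕ T6b's), `Adm`,
`Φ`, `φ` ARBITRARY (unused by existence), from DISPLAYED data only:
* the PER-MEMBER LAWS — towers «Bʲ(y) ⊂ Ω_j» at every truncation (T5 displays the same text), the truncation relations №8 (`trunc_lt` ∕ `trunc_top` shape of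
  `Node00.IdxB8Laws`), the torus data `Lʲ ∣ p a`, `Λ_j^{(m)} + (P∕Lʲ)e_i = Λ_j^{(m)}`, `Ω_j` `(p a)`-periodic (T5's `hΩp` text);
* the b9 socket of Proposition 3's frame `B8LeafModelZd3.SockB9P3` at `B₈` and every level `1 ≤ m < k` ([4] Thm 3.3, served by r02's b9-of-frame line);
* ONE SUPPLIER `hLet` of the [4] LETTERS at `((ι a), n, U₀)` for every `(p a)`-periodic unitary `U₀ ∈ 𝔄_k({Ω_j}, α₀)` and every truncation `1 ≤ n ≤ k`: the
  linear maps `G′, Δ↾Ω₀, Q′, Q′ᵀ𝔄, 𝔄, C, H′` with (E1) `g_rightΩ` ∕ (E2) `c_range` at periodic arguments, (P) `hGper` ∕ `hqcq_per`, the readings `hΔ hqs hq`,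
  the `H′` laws `hH0 hH1 hH2 hHsupp hHequiv hHper hQH`, the `G′` laws `hG hGsupp hGreal`, the remainder laws `hRbd hRreal` — EXACTLY the list of FILE 1's
  module docstring (`B8Prop5NestedServerPerBody`), conjoined behind one `∃ g Δ q qs Aw c H'`; NONE of them is served at nested `Ω_j` in lit-balaban today
  (pub-ymgap node N06's periodic Green's-function line; the all-torus versions are `B8Thm2TorusLettersPer.LettersAtPer`'s fields);
* ONE window hypothesis `hwin` below the threshold `cP`: the JOIN's scalar windows at `c⋆ = 5dLB₈(α₀+α₁)`, `α₄ = 8B₀′(5dLB₈)(α₀+α₁)` ((1.108)'s radius,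
  `B₁ := 5dL·B₈`), `c_B = c_A = L·c⋆`, `c_DA = 2dL²c⋆`, remainder constant `B_R` as the supplier's — the conjunction of
  `B8Thm2TorusServerPer.sockP5Step_of_lettersAtPer`'s `hwin` with `B₀ ↦ B₈`, `B_R + 2 ↦ B_R` (constants only; their joint satisfiability for small
  `α₀ + α₁` is the threshold provider's business, as on the all-torus line).
THE TWO THEOREMS: ★★★ `sockP5Per_of_lettersAtPerNested` (T5's `SP5`), ★★★ `sockP5basePer_of_lettersAtPerNested` (T5's `SP5base`, needs also `2 ≤ 5dLB₈`, p. 89).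
PROOFS: `intro` the socket's prefix, read the letters at `n := m + 1` (resp. `1`) and the windows, and call FILE 1's `sP5_body_of_join_per` ∕
`sP5base_body_of_join_per` (whose engines are the nested periodic ∃λ-storeys `B8SockHFPTraceFreePer.sockHFP_body_of_join_RD_traceFree_per` ∕ `sockHFP₀_…`
at `τ := 0`, `G := U(𝔸)`).  T5's `(1.35)` antecedent is in the end-block `∨` form and its `hΩp` in `T4TermwiseTorus.IsPeriodic` form — both read as displayed.

HONEST SCOPE.  Compositions of landed theorems BY NAME; Proposition 5, Sect. E, [4] Thms 3.1 ∕ 3.3, [3] Prop. 10 are NOT re-proved — letters, b9 socket and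
windows are displayed hypotheses; `≤` where print has `<` in (1.108) (T5's currency); a server does NOT discharge N05 (n05-c's consumers bear on
stmt-QuantumFields-27364); count-neutral; `T_η` read as `P`-periodic data on `ηℤᵈ`; one finite `T⁴` programme at fixed `ε` — nothing continuum ∕ ℝ⁴ ∕ OS ∕
mass-gap ∕ Clay: the Yang–Mills mass gap is NOT proved here or by anything this file feeds.  No `sorry`, no `def`, no `instance`, no `notation`.
-/

noncomputable section

open NormedSpace
open scoped BigOperators

namespace Literature.MathematicalPhysics.QuantumFieldTheory.Balaban1983to89.B8Prop5NestedServerPer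

open B7Prop1Explicit B7Prop2Explicit B7Prop1Local B7Eq92Concrete
open B7Prop2Explicit (C0 c2')
open B7Prop3Flat (c3)
open B7Prop10General (C6 C4G)
open B7Prop9Flat (C5')
open B7Eq78Linearization (zdBlocking QprimeIter)
open B8Ineq130 (tlo thi)
open B8Ineq132 (covDerivFwd InAk)
open B8Eq119TwistedAxial (Restr129 InAx bgT)
open B8Eq184Proof (gaugeExp cfgExp)
open B8Lemma1NonAbelian (mulCfg)
open B8Eq140Level (SideTouches)
open B8Eq138LandauZd (IsLandau138W covLap QT)
open B8Ineq125Concrete (C2p)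
open B8Eq1117Concrete (XSpace)
open B8Prop5ContractionKLevel (Bd2 Mc Kc)
open B8LambdaSpaceKLevel (wt)
open B8LeafModelZd (ZdIdx)
open B8LeafModelZd3 (SockB9P3)
open B8Prop5NestedServerPerBody (sP5_body_of_join_per sP5base_body_of_join_per)
open QuantumLattice (blockSites)
open T4TermwiseTorus (IsPeriodic)

-- `Site` alone could resolve to the torus sites of `Setup.lean`; re-export the `ℤ^d` sites of `B7Prop1Explicit`.
export B7Prop1Explicit (Site)

variable {d : ℕ}

section Sockets

variable {𝔸 : Type*} [CStarAlgebra 𝔸] [Nontrivial 𝔸]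

/-- ★★★ **pub-ymgap T5's GUARDED SOCKET `SP5` :131–:149 (PROPOSITION 5, EXISTENCE AT LEVEL `m + 1`, PERIODIC ARGUMENTS, NESTED `P`-PERIODIC MEMBERS) —
THE BINDER TEXT VERBATIM at instance (i) `LanF a U₀ φ m W := IsLandau138W L m (ι a).η ((ι a).Ω 0) ((ι a).Λs m) U₀ W`** (`Adm`, `Φ`, `φ` arbitrary), over an
index map `ι : J → ZdIdx d L` and a period map `p : J → ℕ`, FROM: the per-member laws (towers at every truncation, truncation relations, `Lʲ ∣ p a`,
`Λ_j^{(m)}` shift-invariant, `Ω_j` `(p a)`-periodic), the b9 socket of Proposition 3's frame at every `1 ≤ m < k`, ONE DISPLAYED SUPPLIER `hLet` of the [4]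
letters at `((ι a), n, U₀)` for every periodic unitary `U₀ ∈ 𝔄_k({Ω_j}, α₀)` and every truncation `1 ≤ n ≤ k` (linear maps `G′, Δ↾Ω₀, Q′, Q′ᵀ𝔄, 𝔄, C, H′` with
(E1) ∕ (E2) ∕ (1.91) at periodic arguments, the readings, the `H′` ∕ `G′` ∕ remainder laws, (P) — the module docstring of FILE 1 lists them), and the JOIN's
scalar windows `hwin` below the threshold `cP` (the shape of `B8Thm2TorusServerPer.sockP5Step_of_lettersAtPer`'s, remainder constant `B_R` as supplied).
PROOF: at each `(a, α₀, α₁, U₀, U′, m, datum)` read the letters at `n := m + 1` and the windows, and call FILE 1's `sP5_body_of_join_per`.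
[cite: Balaban1985RegularSpaces, Prop. 5 (1.107)–(1.108) p.94, Thm 4 p.88, (1.68)–(1.69) p.88, (1.38) p.82, (1.29) p.81, p.77 («Ω_j ⊂ T_η»); Balaban1985BackgroundPropagators, Thm 3.1 p.397, Thm 3.3 p.399, (3.19) p.393] -/
theorem sockP5Per_of_lettersAtPerNested (hd2 : 2 ≤ d) {L : ℕ} (hL : 2 ≤ L)
    {β : ℝ} {len : Site d → ℝ} {B₀' B₈ cP B₀β cB9 B₀'H B₂' BG BR : ℝ}
    (hB₀' : 0 < B₀') (hB₈ : 0 < B₈) (hB₀'H : 0 < B₀'H) (hB₂' : 0 ≤ B₂') (hBG : 0 ≤ BG) (hBR : 0 ≤ BR)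
    {J : Type*} (ι : J → ZdIdx d L) (p : J → ℕ) {Φ : Type*}
    (Adm : J → Φ → (Site d → Fin d → 𝔸ˣ) → ℝ → ℝ → Prop)
    -- PER-MEMBER LAWS (displayed): towers «Bʲ(y) ⊂ Ω_j» at every truncation, the truncation relations of the families `Λs m` ∕ `Λs (m+1)`,
    -- the torus data `Lʲ ∣ P`, `Λ_j^{(m)}` shift-invariant, `Ω_j` `P`-periodic (print's «Ω_j ⊂ T_η», p. 77)
    (htw : ∀ a : J, ∀ m, m ≤ (ι a).k → ∀ j, j ≤ m → ∀ y ∈ (ι a).Λs m j, ∀ x, InBox (tlo L y j) (thi L y j) x → x ∈ (ι a).Ω j)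
    (hlt : ∀ a : J, ∀ m, m < (ι a).k → ∀ j, j < m → (ι a).Λs m j = (ι a).Λs (m + 1) j)
    (htop : ∀ a : J, ∀ m, m < (ι a).k → ∀ x, x ∈ (ι a).Λs m m ↔ x ∈ (ι a).Λs (m + 1) m ∨ ∃ y ∈ (ι a).Λs (m + 1) (m + 1), x ∈ blockSites L y)
    (hdiv : ∀ a : J, ∀ j, j ≤ (ι a).k → ((L : ℤ) ^ j ∣ (p a : ℤ)))
    (hΛ : ∀ a : J, ∀ m, m ≤ (ι a).k → ∀ j, j ≤ m → ∀ (y : Site d) (i : Fin d),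
      y + ((p a : ℤ) / (L : ℤ) ^ j) • e i ∈ (ι a).Λs m j ↔ y ∈ (ι a).Λs m j)
    (hΩp : ∀ a : J, ∀ j, j ≤ (ι a).k → IsPeriodic (p a) (fun x : Site d => x ∈ (ι a).Ω j))
    -- THE b9 SOCKET OF PROPOSITION 3's FRAME AT EVERY LEVEL `1 ≤ m < k` ([4] Thm 3.3; displayed)
    (SB9 : ∀ a : J, ∀ m, 1 ≤ m → m < (ι a).k → SockB9P3 (𝔸 := 𝔸) L B₈ B₀β cB9 β len (ι a).η m (ι a).Ω (ι a).Λs (ι a).Λb)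
    -- THE [4] LETTERS AT NESTED `Ω_j` (displayed supplier; N06's periodic Green's-function line)
    (hLet : ∀ a : J, ∀ α₀ : ℝ, 0 < α₀ → ∀ U₀ : Site d → Fin d → 𝔸ˣ, (∀ x κ, U₀ x κ ∈ unitaryUnits 𝔸) → IsPeriodic (p a) U₀ →
      InAk L (ι a).k (ι a).η α₀ (ι a).Ω U₀ → ∀ n, 1 ≤ n → n ≤ (ι a).k →
      ∃ (g Δ : (Site d → 𝔸) →ₗ[ℂ] (Site d → 𝔸)) (q : (Site d → 𝔸) →ₗ[ℂ] (ℕ → Site d → 𝔸)) (qs : (ℕ → Site d → 𝔸) →ₗ[ℂ] (Site d → 𝔸))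
        (Aw c : (ℕ → Site d → 𝔸) →ₗ[ℂ] (ℕ → Site d → 𝔸)) (H' : XSpace d n 𝔸 →ₗ[ℂ] (Site d → 𝔸)),
        (∀ x, (∀ (z : Site d) (i : Fin d), x (z + (p a : ℤ) • e i) = x z) → ∀ y ∈ (ι a).Ω 0, (Δ (g x) + qs (Aw (q (g x)))) y = x y) ∧
        (∀ f, (∀ (z : Site d) (i : Fin d), f (z + (p a : ℤ) • e i) = f z) → q (g (g (qs (c (q f))))) = q f) ∧
        (∀ (f : Site d → 𝔸) (z : Site d) (i : Fin d), g f (z + (p a : ℤ) • e i) = g f z) ∧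
        (∀ f : Site d → 𝔸, (∀ (z : Site d) (i : Fin d), f (z + (p a : ℤ) • e i) = f z) →
      ∀ (z : Site d) (i : Fin d), qs (c (q f)) (z + (p a : ℤ) • e i) = qs (c (q f)) z) ∧
        (∀ (f : Site d → 𝔸), ∀ x ∈ (ι a).Ω 0, Δ f x = covLap (ι a).η U₀ (((ι a).Ω 0).indicator f) x) ∧
        (∀ (μ : ℕ → Site d → 𝔸), ∀ x ∈ (ι a).Ω 0, qs μ x = QT L n ((ι a).Λs n) U₀ μ x) ∧
        (∀ (f : Site d → 𝔸) (j : ℕ), j ≤ n → ∀ y ∈ (ι a).Λs n j, q f j y = QprimeIter (zdBlocking d L) (bgT L U₀) j f y) ∧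
        (∀ (X : XSpace d n 𝔸) (x : Site d), ‖H' X x‖ ≤ B₀'H * ‖X‖) ∧
        (∀ j, j ≤ n → ∀ (X : XSpace d n 𝔸), ∀ b ∈ {b : Site d × Fin d | SideTouches ((ι a).Ω j) b.1 b.2},
      wt L (ι a).η j * ‖covDerivFwd (ι a).η U₀ b.2 (H' X) b.1‖ ≤ B₀'H * ‖X‖) ∧
        (∀ X : XSpace d n 𝔸, Bd2 L (ι a).η n (ι a).Ω (covLap (ι a).η U₀ (H' X)) (B₂' * ‖X‖)) ∧
        (∀ (X : XSpace d n 𝔸) (x : Site d), x ∉ (ι a).Ω 0 → H' X x = 0) ∧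
        (∀ X Y : XSpace d n 𝔸, (∀ b, Y b = -star (X b)) → ∀ x, H' Y x = -star (H' X x)) ∧
        (∀ X : XSpace d n 𝔸, (∀ (b : Fin (n + 1) × Site d) (i : Fin d), X (b.1, b.2 + ((p a : ℤ) / (L : ℤ) ^ (b.1 : ℕ)) • e i) = X b) →
      ∀ (z : Site d) (i : Fin d), H' X (z + (p a : ℤ) • e i) = H' X z) ∧
        (∀ (Y : XSpace d n 𝔸), (∀ (b : Fin (n + 1) × Site d) (i : Fin d), Y (b.1, b.2 + ((p a : ℤ) / (L : ℤ) ^ (b.1 : ℕ)) • e i) = Y b) →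
      ∀ (j : ℕ) (hj : j ≤ n) (y : Site d), y ∈ (ι a).Λs n j →
      QprimeIter (zdBlocking d L) (bgT L U₀) j (H' Y) y = Y (⟨j, Nat.lt_succ_of_le hj⟩, y)) ∧
        (∀ (f : Site d → 𝔸) (r : ℝ), 0 ≤ r → Bd2 L (ι a).η n (ι a).Ω f r →
      (∀ x, ‖g f x‖ ≤ BG * r) ∧ ∀ j, j ≤ n → ∀ b ∈ {b : Site d × Fin d | SideTouches ((ι a).Ω j) b.1 b.2},
        wt L (ι a).η j * ‖covDerivFwd (ι a).η U₀ b.2 (g f) b.1‖ ≤ BG * r) ∧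
        (∀ (f : Site d → 𝔸) (x : Site d), x ∉ (ι a).Ω 0 → g f x = 0) ∧
        (∀ f : Site d → 𝔸, (∀ j, j ≤ n → ∀ x ∈ (ι a).Ω j, IsSelfAdjoint (f x)) → ∀ x, IsSelfAdjoint (g f x)) ∧
        (∀ (f : Site d → 𝔸) (r : ℝ), 0 ≤ r → Bd2 L (ι a).η n (ι a).Ω f r → Bd2 L (ι a).η n (ι a).Ω (f - g (qs (c (q (g f))))) (BR * r)) ∧
        (∀ f : Site d → 𝔸, (∀ j, j ≤ n → ∀ x ∈ (ι a).Ω j, IsSelfAdjoint (f x)) →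
      ∀ j, j ≤ n → ∀ x ∈ (ι a).Ω j, IsSelfAdjoint ((f - g (qs (c (q (g f))))) x)))
    -- THE JOIN's SCALAR WINDOWS BELOW `cP` (displayed; `c⋆ = 5dLB₈(α₀+α₁)`, `α₄ = 8B₀′(5dLB₈)(α₀+α₁)`, `c_B = c_A = L·c⋆`, `c_DA = 2dL²c⋆`)
    (hwin : ∀ α₀ α₁ : ℝ, 0 < α₀ → 0 < α₁ → α₀ + α₁ ≤ cP → ∀ cs α₄ cB cDA hE hE₂ lE lE₂ : ℝ,
      cs = 5 * (d : ℝ) * L * B₈ * (α₀ + α₁) → α₄ = 8 * B₀' * (5 * (d : ℝ) * L * B₈) * (α₀ + α₁) →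
      cB = L * cs → cDA = 2 * (d : ℝ) * (L : ℝ) ^ 2 * cs →
      hE = B₀'H * (C2p d * (40 * d * cB + α₄) * α₄) → hE₂ = B₂' * (C2p d * (40 * d * cB + α₄) * α₄) →
      lE = B₀'H * (4 * C2p d * (40 * d * cB + 2 * α₄)) → lE₂ = B₂' * (4 * C2p d * (40 * d * cB + 2 * α₄)) →
      36 * d * B₈ * cs ≤ 1 / 2 ∧
      8 * (131072 * ((d : ℝ) + 1) ^ 2) * Real.exp (4 * (800 * ((d : ℝ) + 1) ^ 2 * ((d : ℝ) + 4)) * α₀) ≤ 16 * (131072 * ((d : ℝ) + 1) ^ 2) ∧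
      2 * cs ^ 2 + 20 * d * α₀ * cs + 2 * (16 * (131072 * ((d : ℝ) + 1) ^ 2)) * cs ^ 2 ≤ α₀ + α₁ ∧
      (d : ℝ) * L * α₁ ≤ 1 / 8 ∧
      α₀ ≤ cB9 ∧ cs ≤ cB9 ∧
      C0 d * α₀ ≤ 1 / 3 ∧ 4 * α₀ ≤ c2' d L ∧
      Real.exp (4 * (800 * ((d : ℝ) + 1) ^ 2 * ((d : ℝ) + 4)) * α₀) * (1 + 8 * (131072 * ((d : ℝ) + 1) ^ 2) * cB) ≤ 2 ∧
      2 * cB ≤ c3 d L ∧ 2048 * (d : ℝ) * cB ≤ 1 ∧ 40 * d * cB ≤ 1 / 200 ∧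
      200 * C6 d * (2 * α₄) ≤ 1 ∧ 12000 * ((d : ℝ) + 1) * L * (2 * α₄) ≤ 1 ∧
      C4G d L * (α₀ + 40 * d * cB + 4 * (2 * α₄)) ≤ 1 ∧
      1024 * ((d : ℝ) + 1) * ((d : ℝ) + 4) * L ^ 2 * α₀ ≤ 1 ∧ 32 * ((d : ℝ) + 1) ^ 2 * C6 d * L ^ 2 * α₀ ≤ 1 ∧
      16 * d * C5' d * C6 d * (L : ℝ) ^ 2 * α₀ ≤ 1 ∧ 8 * d * C6 d * L * α₀ ≤ 1 ∧
      40 * d * cB + α₄ ≤ 1 / (4 * B₀'H * (2 * C2p d)) ∧ 2 * C6 d * (40 * d * cB + 4 * α₄) ≤ 1 / 8 ∧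
      cB ≤ 1 / 13 ∧ α₄ / 4 + hE ≤ 1 / 24 ∧ α₄ / 4 + hE ≤ 1 / 140 ∧ 10 * (α₄ / 4 + hE) * BR ≤ 1 / 2 ∧
      BG * Mc d BR (α₄ / 4 + hE) cB hE₂ cDA ≤ α₄ / 4 ∧
      BG * Kc d BR (α₄ / 4 + hE) cB hE₂ cDA lE₂ (1 + lE) (1 + lE) ≤ 1 / 2) :
    ∀ a : J, ∀ α₀ α₁ : ℝ, 0 < α₀ → 0 < α₁ → α₀ + α₁ ≤ cP →
      ∀ U₀ U' : Site d → Fin d → 𝔸ˣ, (∀ x κ, U₀ x κ ∈ unitaryUnits 𝔸) → (∀ x κ, U' x κ ∈ unitaryUnits 𝔸) →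
      IsPeriodic (p a) U₀ → IsPeriodic (p a) U' → ∀ φ : Φ, Adm a φ U₀ α₀ α₁ →
      InAk L (ι a).k (ι a).η α₀ (ι a).Ω U₀ → InAk L (ι a).k (ι a).η α₀ (ι a).Ω (mulCfg U' U₀) → (∀ m, m ≤ (ι a).k → InAx L m ((ι a).Λs m) U₀ (mulCfg U' U₀)) →
      (∀ j, j ≤ (ι a).k → ∀ (z : Site d) (μ : Fin d),
        ((∀ x, InBox (tlo L z j) (thi L z j) x → x ∈ (ι a).Ω j) ∨ (∀ x, InBox (tlo L (z + e μ) j) (thi L (z + e μ) j) x → x ∈ (ι a).Ω j)) →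
        ‖(avgIter L (mulCfg U' U₀) j z μ : 𝔸) - (avgIter L U₀ j z μ : 𝔸)‖ ≤ α₁) →
      (∀ b ∈ {b : Site d × Fin d | SideTouches ((ι a).Ω 0) b.1 b.2}, ‖((U' b.1 b.2 : 𝔸ˣ) : 𝔸) - 1‖ ≤ α₁) →
      (∀ m, 1 ≤ m → m < (ι a).k → ∀ (u₁ : Site d → 𝔸ˣ) (U₁ : Site d → Fin d → 𝔸ˣ) (A : Site d → Fin d → 𝔸),
        (∀ x, u₁ x ∈ unitaryUnits 𝔸) → (∀ x, x ∉ (ι a).Ω 0 → u₁ x = 1) → IsPeriodic (p a) u₁ → IsPeriodic (p a) U₁ → IsPeriodic (p a) A →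
        mgauge U₀ u₁ U₁ = U' → Restr129 L m ((ι a).Λs m) U₀ u₁ → IsLandau138W L m (ι a).η ((ι a).Ω 0) ((ι a).Λs m) U₀ U₁ →
        (∀ j, j ≤ m → ∀ b ∈ {b : Site d × Fin d | SideTouches ((ι a).Ω j) b.1 b.2},
        U₁ b.1 b.2 = cfgExp (ι a).η A b.1 b.2 ∧ IsSelfAdjoint (A b.1 b.2) ∧ ‖A b.1 b.2‖ ≤ (5 * (d : ℝ) * L * B₈ * (α₀ + α₁)) * ((L : ℝ) ^ j * (ι a).η)⁻¹) →
        ∃ (v : Site d → 𝔸ˣ) (lam : Site d → 𝔸), (∀ x, v x ∈ unitaryUnits 𝔸) ∧ (∀ x, x ∉ (ι a).Ω 0 → v x = 1) ∧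
        (∀ j, j ≤ m + 1 → ∀ b ∈ {b : Site d × Fin d | SideTouches ((ι a).Ω j) b.1 b.2}, (v b.1 : 𝔸) = ((gaugeExp lam b.1 : 𝔸ˣ) : 𝔸) ∧
        (v (b.1 + e b.2) : 𝔸) = ((gaugeExp lam (b.1 + e b.2) : 𝔸ˣ) : 𝔸)) ∧
        (∀ j, j ≤ m + 1 → ∀ b ∈ {b : Site d × Fin d | SideTouches ((ι a).Ω j) b.1 b.2},
        ‖lam b.1‖ ≤ (8 * B₀' * (5 * (d : ℝ) * L * B₈) * (α₀ + α₁)) ∧ ((L : ℝ) ^ j * (ι a).η) * ‖covDerivFwd (ι a).η U₀ b.2 lam b.1‖ ≤ (8 * B₀' * (5 * (d : ℝ) * L * B₈) * (α₀ + α₁))) ∧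
        IsLandau138W L (m + 1) (ι a).η ((ι a).Ω 0) ((ι a).Λs (m + 1)) U₀ (mgauge U₀ v⁻¹ U₁) ∧ Restr129 L (m + 1) ((ι a).Λs (m + 1)) U₀ (u₁ * v) ∧ IsPeriodic (p a) v) := by
  intro a α₀ α₁ hα₀ hα₁ hs U₀ U' hU₀ hU' hU₀p _hU'p φ _hAdm h33 h34 hAx h135 _h66 m hm1 hmk u₁ U₁ A hu₁ _hsupp hu₁p _hU₁p hAp hW h129 hLan hdat
  obtain ⟨g, Δ, q, qs, Aw, c, H', g_rightΩ, c_range, hGper, hqcq_per, hΔ, hqs, hq, hH0, hH1, hH2, hHsupp, hHequiv, hHper, hQH, hG, hGsupp, hGreal, hRbd, hRreal⟩ :=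
    hLet a α₀ hα₀ U₀ hU₀ hU₀p h33 (m + 1) (by omega) hmk
  obtain ⟨hside, hC₂, h61, hsmall₁, hα₀9, hcs9, hα3, hα4, hsmall, hc₃, hsc, hα₃', hs₁, hs₂, hs₃, hs₄, hs₅, hs₆, hs₇, hsm, hprod8, hcA', ha₁', hb₁', hθ, h103, h106⟩ :=
    hwin α₀ α₁ hα₀ hα₁ hs _ _ _ _ _ _ _ _ rfl rfl rfl rfl rfl rfl rfl rfl
  have hcs0 : 0 ≤ 5 * (d : ℝ) * L * B₈ * (α₀ + α₁) := by
    have : 0 ≤ α₀ + α₁ := by linarith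
    positivity
  have hcDAlo : (d : ℝ) * (L : ℝ) ^ 2 * (5 * (d : ℝ) * L * B₈ * (α₀ + α₁)) ≤ 2 * (d : ℝ) * (L : ℝ) ^ 2 * (5 * (d : ℝ) * L * B₈ * (α₀ + α₁)) := by
    have h := mul_nonneg (by positivity : (0 : ℝ) ≤ (d : ℝ) * (L : ℝ) ^ 2) hcs0
    linarith only [h]
  exact sP5_body_of_join_per hd2 hL (ι a).hη (p a) (ι a).hΩ (ι a).hbox (ι a).hclass hm1 hmk (htw a (m + 1) hmk) (hlt a m hmk) (htop a m hmk)
    hα₀ hα₁ hB₈ hB₀' rfl rfl hU₀ hU' hU₀p h33 h34 hAx h135 hu₁ hu₁p hAp hW h129 hLan hdat (SB9 a m hm1 hmk) hα₀9 hcs9 hside hC₂ h61 hsmall₁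
    g Δ q qs Aw c g_rightΩ c_range (fun j hj => hdiv a j (by omega)) (fun j hj => hΛ a (m + 1) hmk j hj) (fun j hj => hΩp a j (by omega))
    hGper hqcq_per hΔ hqs hq H' hB₀'H hB₂' hBG hBR hH0 hH1 hH2 hHsupp hHequiv hHper hQH hG hGsupp hGreal hRbd hRreal
    le_rfl le_rfl hcDAlo hα3 hα4 hsmall hc₃ hsc hα₃' hs₁ hs₂ hs₃ hs₄ hs₅ hs₆ hs₇ hsm hprod8 rfl rfl rfl rfl hcA' ha₁' hb₁' hθ h103 h106

/-- ★★★ **pub-ymgap T5's GUARDED SOCKET `SP5base` :117–:130 (PROPOSITION 5, EXISTENCE AT LEVEL `1` FROM `u₁ = 1`, `U₁ = U′`, p. 89; PERIODIC ARGUMENTS,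
NESTED `P`-PERIODIC MEMBERS) — THE BINDER TEXT VERBATIM at instance (i) `LanF := IsLandau138W`**, from the same displayed data as `sockP5Per_of_lettersAtPerNested`
plus `2 ≤ 5dLB₈` («B₁ not too small», p. 89).  PROOF: letters at `n := 1`, windows, FILE 1's `sP5base_body_of_join_per`.
[cite: Balaban1985RegularSpaces, Prop. 5 (1.107)–(1.108) p.94, p.89, (1.66) p.88, Thm 4 p.88, (1.38) p.82, (1.29) p.81, p.77 («Ω_j ⊂ T_η»); Balaban1985BackgroundPropagators, Thm 3.1 p.397, (3.19) p.393] -/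
theorem sockP5basePer_of_lettersAtPerNested (hd2 : 2 ≤ d) {L : ℕ} (hL : 2 ≤ L)
    {B₀' B₈ cP cB9 B₀'H B₂' BG BR : ℝ}
    (hB₀' : 0 < B₀') (hB₈ : 0 < B₈) (hB₀'H : 0 < B₀'H) (hB₂' : 0 ≤ B₂') (hBG : 0 ≤ BG) (hBR : 0 ≤ BR)
    {J : Type*} (ι : J → ZdIdx d L) (p : J → ℕ) {Φ : Type*}
    (Adm : J → Φ → (Site d → Fin d → 𝔸ˣ) → ℝ → ℝ → Prop)
    -- PER-MEMBER LAWS (displayed): towers «Bʲ(y) ⊂ Ω_j» at every truncation (only truncation `1` is read),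
    -- the torus data `Lʲ ∣ P`, `Λ_j^{(m)}` shift-invariant, `Ω_j` `P`-periodic (print's «Ω_j ⊂ T_η», p. 77)
    (htw : ∀ a : J, ∀ m, m ≤ (ι a).k → ∀ j, j ≤ m → ∀ y ∈ (ι a).Λs m j, ∀ x, InBox (tlo L y j) (thi L y j) x → x ∈ (ι a).Ω j)
    (hdiv : ∀ a : J, ∀ j, j ≤ (ι a).k → ((L : ℤ) ^ j ∣ (p a : ℤ)))
    (hΛ : ∀ a : J, ∀ m, m ≤ (ι a).k → ∀ j, j ≤ m → ∀ (y : Site d) (i : Fin d),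
      y + ((p a : ℤ) / (L : ℤ) ^ j) • e i ∈ (ι a).Λs m j ↔ y ∈ (ι a).Λs m j)
    (hΩp : ∀ a : J, ∀ j, j ≤ (ι a).k → IsPeriodic (p a) (fun x : Site d => x ∈ (ι a).Ω j))
    (hB : 2 ≤ 5 * (d : ℝ) * L * B₈)
    -- THE [4] LETTERS AT NESTED `Ω_j` (displayed supplier; N06's periodic Green's-function line)
    (hLet : ∀ a : J, ∀ α₀ : ℝ, 0 < α₀ → ∀ U₀ : Site d → Fin d → 𝔸ˣ, (∀ x κ, U₀ x κ ∈ unitaryUnits 𝔸) → IsPeriodic (p a) U₀ →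
      InAk L (ι a).k (ι a).η α₀ (ι a).Ω U₀ → ∀ n, 1 ≤ n → n ≤ (ι a).k →
      ∃ (g Δ : (Site d → 𝔸) →ₗ[ℂ] (Site d → 𝔸)) (q : (Site d → 𝔸) →ₗ[ℂ] (ℕ → Site d → 𝔸)) (qs : (ℕ → Site d → 𝔸) →ₗ[ℂ] (Site d → 𝔸))
        (Aw c : (ℕ → Site d → 𝔸) →ₗ[ℂ] (ℕ → Site d → 𝔸)) (H' : XSpace d n 𝔸 →ₗ[ℂ] (Site d → 𝔸)),
        (∀ x, (∀ (z : Site d) (i : Fin d), x (z + (p a : ℤ) • e i) = x z) → ∀ y ∈ (ι a).Ω 0, (Δ (g x) + qs (Aw (q (g x)))) y = x y) ∧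
        (∀ f, (∀ (z : Site d) (i : Fin d), f (z + (p a : ℤ) • e i) = f z) → q (g (g (qs (c (q f))))) = q f) ∧
        (∀ (f : Site d → 𝔸) (z : Site d) (i : Fin d), g f (z + (p a : ℤ) • e i) = g f z) ∧
        (∀ f : Site d → 𝔸, (∀ (z : Site d) (i : Fin d), f (z + (p a : ℤ) • e i) = f z) →
      ∀ (z : Site d) (i : Fin d), qs (c (q f)) (z + (p a : ℤ) • e i) = qs (c (q f)) z) ∧
        (∀ (f : Site d → 𝔸), ∀ x ∈ (ι a).Ω 0, Δ f x = covLap (ι a).η U₀ (((ι a).Ω 0).indicator f) x) ∧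
        (∀ (μ : ℕ → Site d → 𝔸), ∀ x ∈ (ι a).Ω 0, qs μ x = QT L n ((ι a).Λs n) U₀ μ x) ∧
        (∀ (f : Site d → 𝔸) (j : ℕ), j ≤ n → ∀ y ∈ (ι a).Λs n j, q f j y = QprimeIter (zdBlocking d L) (bgT L U₀) j f y) ∧
        (∀ (X : XSpace d n 𝔸) (x : Site d), ‖H' X x‖ ≤ B₀'H * ‖X‖) ∧
        (∀ j, j ≤ n → ∀ (X : XSpace d n 𝔸), ∀ b ∈ {b : Site d × Fin d | SideTouches ((ι a).Ω j) b.1 b.2},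
      wt L (ι a).η j * ‖covDerivFwd (ι a).η U₀ b.2 (H' X) b.1‖ ≤ B₀'H * ‖X‖) ∧
        (∀ X : XSpace d n 𝔸, Bd2 L (ι a).η n (ι a).Ω (covLap (ι a).η U₀ (H' X)) (B₂' * ‖X‖)) ∧
        (∀ (X : XSpace d n 𝔸) (x : Site d), x ∉ (ι a).Ω 0 → H' X x = 0) ∧
        (∀ X Y : XSpace d n 𝔸, (∀ b, Y b = -star (X b)) → ∀ x, H' Y x = -star (H' X x)) ∧
        (∀ X : XSpace d n 𝔸, (∀ (b : Fin (n + 1) × Site d) (i : Fin d), X (b.1, b.2 + ((p a : ℤ) / (L : ℤ) ^ (b.1 : ℕ)) • e i) = X b) →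
      ∀ (z : Site d) (i : Fin d), H' X (z + (p a : ℤ) • e i) = H' X z) ∧
        (∀ (Y : XSpace d n 𝔸), (∀ (b : Fin (n + 1) × Site d) (i : Fin d), Y (b.1, b.2 + ((p a : ℤ) / (L : ℤ) ^ (b.1 : ℕ)) • e i) = Y b) →
      ∀ (j : ℕ) (hj : j ≤ n) (y : Site d), y ∈ (ι a).Λs n j →
      QprimeIter (zdBlocking d L) (bgT L U₀) j (H' Y) y = Y (⟨j, Nat.lt_succ_of_le hj⟩, y)) ∧
        (∀ (f : Site d → 𝔸) (r : ℝ), 0 ≤ r → Bd2 L (ι a).η n (ι a).Ω f r →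
      (∀ x, ‖g f x‖ ≤ BG * r) ∧ ∀ j, j ≤ n → ∀ b ∈ {b : Site d × Fin d | SideTouches ((ι a).Ω j) b.1 b.2},
        wt L (ι a).η j * ‖covDerivFwd (ι a).η U₀ b.2 (g f) b.1‖ ≤ BG * r) ∧
        (∀ (f : Site d → 𝔸) (x : Site d), x ∉ (ι a).Ω 0 → g f x = 0) ∧
        (∀ f : Site d → 𝔸, (∀ j, j ≤ n → ∀ x ∈ (ι a).Ω j, IsSelfAdjoint (f x)) → ∀ x, IsSelfAdjoint (g f x)) ∧
        (∀ (f : Site d → 𝔸) (r : ℝ), 0 ≤ r → Bd2 L (ι a).η n (ι a).Ω f r → Bd2 L (ι a).η n (ι a).Ω (f - g (qs (c (q (g f))))) (BR * r)) ∧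
        (∀ f : Site d → 𝔸, (∀ j, j ≤ n → ∀ x ∈ (ι a).Ω j, IsSelfAdjoint (f x)) →
      ∀ j, j ≤ n → ∀ x ∈ (ι a).Ω j, IsSelfAdjoint ((f - g (qs (c (q (g f))))) x)))
    -- THE JOIN's SCALAR WINDOWS BELOW `cP` (displayed)
    (hwin : ∀ α₀ α₁ : ℝ, 0 < α₀ → 0 < α₁ → α₀ + α₁ ≤ cP → ∀ cs α₄ cB cDA hE hE₂ lE lE₂ : ℝ,
      cs = 5 * (d : ℝ) * L * B₈ * (α₀ + α₁) → α₄ = 8 * B₀' * (5 * (d : ℝ) * L * B₈) * (α₀ + α₁) →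
      cB = L * cs → cDA = 2 * (d : ℝ) * (L : ℝ) ^ 2 * cs →
      hE = B₀'H * (C2p d * (40 * d * cB + α₄) * α₄) → hE₂ = B₂' * (C2p d * (40 * d * cB + α₄) * α₄) →
      lE = B₀'H * (4 * C2p d * (40 * d * cB + 2 * α₄)) → lE₂ = B₂' * (4 * C2p d * (40 * d * cB + 2 * α₄)) →
      36 * d * B₈ * cs ≤ 1 / 2 ∧
      8 * (131072 * ((d : ℝ) + 1) ^ 2) * Real.exp (4 * (800 * ((d : ℝ) + 1) ^ 2 * ((d : ℝ) + 4)) * α₀) ≤ 16 * (131072 * ((d : ℝ) + 1) ^ 2) ∧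
      2 * cs ^ 2 + 20 * d * α₀ * cs + 2 * (16 * (131072 * ((d : ℝ) + 1) ^ 2)) * cs ^ 2 ≤ α₀ + α₁ ∧
      (d : ℝ) * L * α₁ ≤ 1 / 8 ∧
      α₀ ≤ cB9 ∧ cs ≤ cB9 ∧
      C0 d * α₀ ≤ 1 / 3 ∧ 4 * α₀ ≤ c2' d L ∧
      Real.exp (4 * (800 * ((d : ℝ) + 1) ^ 2 * ((d : ℝ) + 4)) * α₀) * (1 + 8 * (131072 * ((d : ℝ) + 1) ^ 2) * cB) ≤ 2 ∧
      2 * cB ≤ c3 d L ∧ 2048 * (d : ℝ) * cB ≤ 1 ∧ 40 * d * cB ≤ 1 / 200 ∧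
      200 * C6 d * (2 * α₄) ≤ 1 ∧ 12000 * ((d : ℝ) + 1) * L * (2 * α₄) ≤ 1 ∧
      C4G d L * (α₀ + 40 * d * cB + 4 * (2 * α₄)) ≤ 1 ∧
      1024 * ((d : ℝ) + 1) * ((d : ℝ) + 4) * L ^ 2 * α₀ ≤ 1 ∧ 32 * ((d : ℝ) + 1) ^ 2 * C6 d * L ^ 2 * α₀ ≤ 1 ∧
      16 * d * C5' d * C6 d * (L : ℝ) ^ 2 * α₀ ≤ 1 ∧ 8 * d * C6 d * L * α₀ ≤ 1 ∧
      40 * d * cB + α₄ ≤ 1 / (4 * B₀'H * (2 * C2p d)) ∧ 2 * C6 d * (40 * d * cB + 4 * α₄) ≤ 1 / 8 ∧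
      cB ≤ 1 / 13 ∧ α₄ / 4 + hE ≤ 1 / 24 ∧ α₄ / 4 + hE ≤ 1 / 140 ∧ 10 * (α₄ / 4 + hE) * BR ≤ 1 / 2 ∧
      BG * Mc d BR (α₄ / 4 + hE) cB hE₂ cDA ≤ α₄ / 4 ∧
      BG * Kc d BR (α₄ / 4 + hE) cB hE₂ cDA lE₂ (1 + lE) (1 + lE) ≤ 1 / 2) :
    ∀ a : J, ∀ α₀ α₁ : ℝ, 0 < α₀ → 0 < α₁ → α₀ + α₁ ≤ cP →
      ∀ U₀ U' : Site d → Fin d → 𝔸ˣ, (∀ x κ, U₀ x κ ∈ unitaryUnits 𝔸) → (∀ x κ, U' x κ ∈ unitaryUnits 𝔸) →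
      IsPeriodic (p a) U₀ → IsPeriodic (p a) U' → ∀ φ : Φ, Adm a φ U₀ α₀ α₁ →
      InAk L (ι a).k (ι a).η α₀ (ι a).Ω U₀ → InAk L (ι a).k (ι a).η α₀ (ι a).Ω (mulCfg U' U₀) → (∀ m, m ≤ (ι a).k → InAx L m ((ι a).Λs m) U₀ (mulCfg U' U₀)) →
      (∀ j, j ≤ (ι a).k → ∀ (z : Site d) (μ : Fin d),
        ((∀ x, InBox (tlo L z j) (thi L z j) x → x ∈ (ι a).Ω j) ∨ (∀ x, InBox (tlo L (z + e μ) j) (thi L (z + e μ) j) x → x ∈ (ι a).Ω j)) →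
        ‖(avgIter L (mulCfg U' U₀) j z μ : 𝔸) - (avgIter L U₀ j z μ : 𝔸)‖ ≤ α₁) →
      (∀ b ∈ {b : Site d × Fin d | SideTouches ((ι a).Ω 0) b.1 b.2}, ‖((U' b.1 b.2 : 𝔸ˣ) : 𝔸) - 1‖ ≤ α₁) →
      (∃ (v : Site d → 𝔸ˣ) (lam : Site d → 𝔸), (∀ x, v x ∈ unitaryUnits 𝔸) ∧ (∀ x, x ∉ (ι a).Ω 0 → v x = 1) ∧
        (∀ j, j ≤ 1 → ∀ b ∈ {b : Site d × Fin d | SideTouches ((ι a).Ω j) b.1 b.2}, (v b.1 : 𝔸) = ((gaugeExp lam b.1 : 𝔸ˣ) : 𝔸) ∧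
        (v (b.1 + e b.2) : 𝔸) = ((gaugeExp lam (b.1 + e b.2) : 𝔸ˣ) : 𝔸)) ∧
        (∀ j, j ≤ 1 → ∀ b ∈ {b : Site d × Fin d | SideTouches ((ι a).Ω j) b.1 b.2},
        ‖lam b.1‖ ≤ (8 * B₀' * (5 * (d : ℝ) * L * B₈) * (α₀ + α₁)) ∧ ((L : ℝ) ^ j * (ι a).η) * ‖covDerivFwd (ι a).η U₀ b.2 lam b.1‖ ≤ (8 * B₀' * (5 * (d : ℝ) * L * B₈) * (α₀ + α₁))) ∧
        IsLandau138W L 1 (ι a).η ((ι a).Ω 0) ((ι a).Λs 1) U₀ (mgauge U₀ v⁻¹ U') ∧ Restr129 L 1 ((ι a).Λs 1) U₀ ((1 : Site d → 𝔸ˣ) * v) ∧ IsPeriodic (p a) v) := by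
  intro a α₀ α₁ hα₀ hα₁ hs U₀ U' hU₀ hU' hU₀p hU'p φ _hAdm h33 h34 hAx _h135 h66
  obtain ⟨g, Δ, q, qs, Aw, c, H', g_rightΩ, c_range, hGper, hqcq_per, hΔ, hqs, hq, hH0, hH1, hH2, hHsupp, hHequiv, hHper, hQH, hG, hGsupp, hGreal, hRbd, hRreal⟩ :=
    hLet a α₀ hα₀ U₀ hU₀ hU₀p h33 1 le_rfl (ι a).hk
  obtain ⟨hside, hC₂, h61, hsmall₁, hα₀9, hcs9, hα3, hα4, hsmall, hc₃, hsc, hα₃', hs₁, hs₂, hs₃, hs₄, hs₅, hs₆, hs₇, hsm, hprod8, hcA', ha₁', hb₁', hθ, h103, h106⟩ :=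
    hwin α₀ α₁ hα₀ hα₁ hs _ _ _ _ _ _ _ _ rfl rfl rfl rfl rfl rfl rfl rfl
  exact sP5base_body_of_join_per hd2 hL (ι a).hη (p a) (ι a).hk (ι a).hΩ (htw a 1 (ι a).hk) hα₀ hα₁ hB₈ hB₀' hB rfl rfl hU₀ hU' hU₀p hU'p
    h33 h34 hAx h66 g Δ q qs Aw c g_rightΩ c_range (fun j hj => hdiv a j (hj.trans (ι a).hk)) (fun j hj => hΛ a 1 (ι a).hk j hj)
    (hΩp a 0 (Nat.zero_le _)) hGper hqcq_per hΔ hqs hq H' hB₀'H hB₂' hBG hBR hH0 hH1 hH2 hHsupp hHequiv hHper hQH hG hGsupp hGreal hRbd hRreal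
    le_rfl le_rfl le_rfl hα3 hα4 hsmall hc₃ hsc hα₃' hs₁ hs₂ hs₃ hs₄ hs₅ hs₆ hs₇ hsm hprod8 rfl rfl rfl rfl hcA' ha₁' hb₁' hθ h103 h106

#print axioms sockP5Per_of_lettersAtPerNested
#print axioms sockP5basePer_of_lettersAtPerNested

end Sockets

end Literature.MathematicalPhysics.QuantumFieldTheory.Balaban1983to89.B8Prop5NestedServerPer

end
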